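import Summits.Langlands.Langlands.Theses.TrigonalHeartLimit
import Literature.NumberTheory.EllipticCurves.NewformGaloisRep

/-!
# Birth skeleton (BC3) for piece `ResidualWeightRaisingAtThree` of the split of
# `TrigonalHeartLimit.OddResidualAutomorphyAtThree` (crux item stmt-Langlands-13672)

Residual weight raising at `p = 3`, in print: an L-algebraic cuspidal `π` of `GL₂(𝔸_ℚ)` carrying
(through `red : 𝒪_{ℚ̄₃} → k`, `ι : ℚ̄₃ ≃ ℂ`) the residual datum of an ODD irreducible `τ` either
has a regular infinity type (done) or — parity of the central character, forced by the oddness of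
`τ` — is of holomorphic weight-ONE type, i.e. comes from a weight-one newform `f` to which `τ` is
attached (`stub_weightOneDescent`, the automorphic → classical dictionary); Deligne–Serre's
`f ↦ f · E₄` (`E₄ ≡ 1 mod 3`) followed by their lifting lemma (Lemme 6.11) gives a newform `g` of
weight `≥ 2` whose integral Hecke polynomials are congruent to those of `f` away from `3 N N'`
(`stub_haseWeightRaising`, purely classical); and the classical → automorphic dictionary in the
L-normalisation with PRESCRIBED residue maps (`stub_adelisationRegularL` — the KW-free half of the
landed sibling assembly `PhantomRMYoshidaSerreKWAutomorphicGL2` (residue-adapted embedding,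
conjugate newform, adelic lift, arch parameter, double twist), plus the regularity `w ≥ 2` it
already computes) returns a REGULAR L-algebraic `π'` with the same residual datum.
`ResidualWeightRaisingAtThree_of : ResidualWeightRaisingAtThree` composes the three (no `sorry` outside the stubs): case split on regularity; in
the irregular case the attachment of `τ` to `g` away from `{q ∣ 3N} ∪ {q ∣ 3NN'}` follows from the
attachment to `f` and the congruence by injectivity of `𝓞_f → K_f`.
-/

noncomputable section

set_option linter.dupNamespace false

namespace Summit.Langlands.Langlands.Cruxes.OddResidualAutomorphyAtThree.BirthResidualWeightRaisingAtThree

open scoped BigOperators Topology Classical Matrix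
open Filter Set Function IsDedekindDomain Polynomial
open Literature.NumberTheory.EllipticCurves.ModularForms Rat.HeightOneSpectrum

/-- the piece, structurally (it is not yet a route decl). -/
def ResidualWeightRaisingAtThree : Prop :=
  ∀ {k : Type} [Field k] [CharP k 3] [IsAlgClosed k] [TopologicalSpace k] [DiscreteTopology k] (red : Valued.integer (PadicAlgCl 3) →+* k) (ι : PadicAlgCl 3 ≃+* ℂ) (τ : Literature.NumberTheory.GaloisRepresentations.FramedGaloisRep ℚ k 2), τ.toGaloisRep.IsIrreducible → Literature.NumberTheory.GaloisRepresentations.FramedGaloisRep.IsOdd τ → ∀ (hQ : Literature.NumberTheory.Automorphic.isCompact_glFiniteIntegralLevel 2 ℚ) (π : Literature.NumberTheory.Automorphic.CuspidalAutomorphicRepData 2 ℚ hQ), π.1.IsLAlgebraic → (∀ᶠ v : IsDedekindDomain.HeightOneSpectrum (NumberField.RingOfIntegers ℚ) in Filter.cofinite, ∃ (a : Multiset ℂ) (P : Polynomial (Valued.integer (PadicAlgCl 3))), π.1.HasSatakeParamAt v a ∧ P.map (Valued.integer (PadicAlgCl 3)).subtype = Literature.NumberTheory.Automorphic.arithFrobPolyOfSatake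 ι v.residueCard 1 a ∧ τ.HasFrobCharpolyAt v (P.map red)) → ∃ (π' : Literature.NumberTheory.Automorphic.CuspidalAutomorphicRepData 2 ℚ hQ) (T : Literature.NumberTheory.Automorphic.InfinityType ℚ 2), π'.1.HasInfinityType T ∧ T.IsRegular ∧ T.IsLAlgebraic ∧ ∀ᶠ v : IsDedekindDomain.HeightOneSpectrum (NumberField.RingOfIntegers ℚ) in Filter.cofinite, ∃ (a : Multiset ℂ) (P : Polynomial (Valued.integer (PadicAlgCl 3))), π'.1.HasSatakeParamAt v a ∧ P.map (Valued.integer (PadicAlgCl 3)).subtype = Literature.NumberTheory.Automorphic.arithFrobPolyOfSatake ι v.residueCard 1 a ∧ τ.HasFrobCharpolyAt v (P.map red)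

/-- Stub 1 (XL): WEIGHT-ONE DESCENT — an IRREGULAR L-algebraic cuspidal `π` of `GL₂(𝔸_ℚ)` whose
L-normalised Satake polynomials reduce a.e. to the Frobenius polynomials of an ODD irreducible `τ`
is, up to an integral `|det|`-twist and a twist by the Teichmüller lift of a power of the mod-3
cyclotomic character, the automorphic representation of a weight-one newform `f`, and `τ` is
attached to `f` (Frobenius polynomial = reduced Hecke polynomial) away from `3N`.  Parity of the
central character (`τ` odd) excludes the even Maass type `P(1,1) ⊗ |·|^a`.
[cite: DeligneSerreASENS1974, Thm. 4.1] [cite: BuzzardGeeLMS2014, §3.1] -/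
theorem stub_weightOneDescent : ∀ {k : Type} [Field k] [CharP k 3] [IsAlgClosed k] [TopologicalSpace k] [DiscreteTopology k] (red : Valued.integer (PadicAlgCl 3) →+* k) (ι : PadicAlgCl 3 ≃+* ℂ) (τ : Literature.NumberTheory.GaloisRepresentations.FramedGaloisRep ℚ k 2), τ.toGaloisRep.IsIrreducible → Literature.NumberTheory.GaloisRepresentations.FramedGaloisRep.IsOdd τ → ∀ (hQ : Literature.NumberTheory.Automorphic.isCompact_glFiniteIntegralLevel 2 ℚ) (π : Literature.NumberTheory.Automorphic.CuspidalAutomorphicRepData 2 ℚ hQ), (∃ T : Literature.NumberTheory.Automorphic.InfinityType ℚ 2, π.1.HasInfinityType T ∧ T.IsLAlgebraic ∧ ¬ T.IsRegular) → (∀ᶠ v : IsDedekindDomain.HeightOneSpectrum (NumberField.RingOfIntegers ℚ) in Filter.cofinite, ∃ (a : Multiset ℂ) (P : Polynomial (Valued.integer (PadicAlgCl 3))), π.1.HasSatakeParamAt v a ∧ P.map (Valued.integer (PadicAlgCl 3)).subtype = Literature.NumberTheory.Automorphic.arithFrobPolyOfSatake ι v.residueCard 1 a ∧ τ.HasFrobCharpolyAt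 v (P.map red)) → ∃ (N : ℕ) (_ : NeZero N) (f : CuspForm (CongruenceSubgroup.Gamma1 N) 1) (ιf : coeffCharIntegers f →+* k), IsNewform1 f ∧ IsGaloisRepOfNewform1Int f ιf {q : ℕ | q ∣ 3 * N} τ := by
  sorry

/-- Stub 2 (M): HASSE-INVARIANT WEIGHT RAISING (classical) — for a weight-one newform `f` on
`Γ₁(N)` and `ιf : 𝓞_f → k` of characteristic `3`, the form `f · E₄ ∈ S₅(Γ₁(N))` is congruent to
`f` modulo the prime `ker ιf` above `3` (`E₄ ≡ 1 mod 3`); by the Deligne–Serre lifting lemma it is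
congruent to an eigenform, whose newform `g` (weight `w ≥ 2`, level `N' ∣ N`) has integral Hecke
polynomials `X² - a_q(g) X + ε(q) q^(w-1)` reducing, along some `ιg : 𝓞_g → k`, to the reductions
of `X² - a_q(f) X + ε(q)` for every prime `q ∤ 3 N N'` (`q^(w-1) ≡ 1 ≡ q⁰ mod 3`).
[cite: DeligneSerreASENS1974, Lemme 6.11 and §9] -/
theorem stub_haseWeightRaising : ∀ (N : ℕ) [NeZero N] (f : CuspForm (CongruenceSubgroup.Gamma1 N) 1), IsNewform1 f → ∀ {k : Type} [Field k] [CharP k 3] (ιf : coeffCharIntegers f →+* k), ∃ (N' : ℕ) (_ : NeZero N') (w : ℤ), 2 ≤ w ∧ ∃ (g : CuspForm (CongruenceSubgroup.Gamma1 N') w) (ιg : coeffCharIntegers g →+* k), IsNewform1 g ∧ ∀ q : ℕ, q.Prime → ¬ q ∣ 3 * N * N' → ∃ (Pf : Polynomial (coeffCharIntegers f)) (Pg : Polynomial (coeffCharIntegers g)), Pf.map (algebraMap (coeffCharIntegers f) (coeffCharField f)) = heckePolynomial f q ∧ Pg.map (algebraMap (coeffCharIntegers g) (coeffCharField g)) =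 heckePolynomial g q ∧ Pf.map ιf = Pg.map ιg := by
  sorry

/-- Stub 3 (L): ADELISATION IN THE L-NORMALISATION WITH PRESCRIBED RESIDUE MAPS, REGULAR WEIGHT —
if `τ` is attached to a newform `g` of weight `w ≥ 2` along `ιg` away from a finite `S`, then for
every `red : 𝒪_{ℚ̄₃} → k` and `ι : ℚ̄₃ ≃ ℂ` some cuspidal `π'` of `GL₂(𝔸_ℚ)` with a REGULAR
L-algebraic infinity type (`{(w-1, 0), (0, w-1)}` after the double twist) has 3-integral L-normalised
Satake polynomials reducing through `red` to `charpoly τ(Frob_v)` a.e. — the KW-free part of the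
landed assembly `PhantomRMYoshidaSerreKWAutomorphicGL2` (residue-adapted embedding `θ`, Galois-
conjugate newform, adelic lift, arch parameter by cyclicity, double twist `⊗ ε⁻¹∘det ⊗ |det|^((w-1)/2)`),
with the regularity it computes retained. [cite: BuzzardGeeLMS2014, §3.1 and Conj. 3.2.2]
[cite: DeligneSerreASENS1974, (2.7.4)] -/
theorem stub_adelisationRegularL : ∀ {k : Type} [Field k] [CharP k 3] [IsAlgClosed k] [TopologicalSpace k] [DiscreteTopology k] (red : Valued.integer (PadicAlgCl 3) →+* k) (ι : PadicAlgCl 3 ≃+* ℂ) (τ : Literature.NumberTheory.GaloisRepresentations.FramedGaloisRep ℚ k 2) (N : ℕ) [NeZero N] (w : ℤ), 2 ≤ w → ∀ (g : CuspForm (CongruenceSubgroup.Gamma1 N) w) (ιg : coeffCharIntegers g →+* k) (S : Set ℕ), S.Finite → IsNewform1 g → IsGaloisRepOfNewform1Int g ιg S τ → ∀ (hQ : Literature.NumberTheory.Automorphic.isCompact_glFiniteIntegralLevel 2 ℚ), ∃ (π' : Literature.NumberTheory.Automorphic.CuspidalAutomorphicRepData 2 ℚ hQ) (T : Literature.NumberTheory.Automorphic.InfinityType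 ℚ 2), π'.1.HasInfinityType T ∧ T.IsRegular ∧ T.IsLAlgebraic ∧ ∀ᶠ v : IsDedekindDomain.HeightOneSpectrum (NumberField.RingOfIntegers ℚ) in Filter.cofinite, ∃ (a : Multiset ℂ) (P : Polynomial (Valued.integer (PadicAlgCl 3))), π'.1.HasSatakeParamAt v a ∧ P.map (Valued.integer (PadicAlgCl 3)).subtype = Literature.NumberTheory.Automorphic.arithFrobPolyOfSatake ι v.residueCard 1 a ∧ τ.HasFrobCharpolyAt v (P.map red) := by
  sorry

/-- `{q | q ∣ m}` is finite for `m ≠ 0`. -/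
theorem finite_setOf_dvd {m : ℕ} (hm : m ≠ 0) : {q : ℕ | q ∣ m}.Finite :=
  (Nat.divisors m).finite_toSet.subset fun q hq => by
    simpa [Nat.mem_divisors] using And.intro hq hm

/-- **Composition (kernel-checked, no `sorry` outside the three stubs): the stubs imply the piece.**
Case split on regularity of the infinity type of `π`; in the irregular case: weight-one descent
(`stub_weightOneDescent`), Hasse/Deligne–Serre weight raising (`stub_haseWeightRaising`), and the
regular L-normalised adelisation with prescribed residue maps (`stub_adelisationRegularL`); the
attachment of `τ` is transported from `f` to `g` by injectivity of `𝓞_f → K_f`. -/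
theorem ResidualWeightRaisingAtThree_of : ResidualWeightRaisingAtThree := by
  intro k _ _ _ _ _ red ι τ hirr hodd hQ π hLalg hres
  obtain ⟨T, hT, hL⟩ := hLalg
  by_cases hreg : T.IsRegular
  · -- regular: nothing to do
    exact ⟨π, T, hT, hreg, hL, hres⟩
  · -- irregular: weight-one descent, Hasse weight raising, regular adelisation
    obtain ⟨N, hN, f, ιf, hf, hfτ⟩ := stub_weightOneDescent red ι τ hirr hodd hQ π ⟨T, hT, hL, hreg⟩ hres
    obtain ⟨N', hN', w, hw, g, ιg, hg, hcong⟩ := stub_haseWeightRaising N f hf ιf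
    have hS : ({q : ℕ | q ∣ 3 * N} ∪ {q : ℕ | q ∣ 3 * N * N'}).Finite :=
      (finite_setOf_dvd (by have := hN.out; positivity)).union
        (finite_setOf_dvd (by have := hN.out; have := hN'.out; positivity))
    have hinj : Function.Injective (algebraMap (coeffCharIntegers f) (coeffCharField f)) :=
      fun x y hxy => Subtype.ext hxy
    have hgτ : IsGaloisRepOfNewform1Int g ιg ({q : ℕ | q ∣ 3 * N} ∪ {q : ℕ | q ∣ 3 * N * N'}) τ := by
      intro v hv
      simp only [Set.mem_union, Set.mem_setOf_eq, not_or] at hv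
      obtain ⟨hur, Pf, hPf, hch⟩ := hfτ v hv.1
      obtain ⟨Pf', Pg, hPf', hPg, hcongr⟩ := hcong _ (primesEquiv v).prop hv.2
      have hPP : Pf = Pf' := Polynomial.map_injective _ hinj (hPf.trans hPf'.symm)
      refine ⟨hur, Pg, hPg, ?_⟩
      rw [← hcongr, ← hPP]
      exact hch
    exact stub_adelisationRegularL red ι τ N' w hw g ιg _ hS hg hgτ hQ

end Summit.Langlands.Langlands.Cruxes.OddResidualAutomorphyAtThree.BirthResidualWeightRaisingAtThree
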